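import Mathlib
import HarnessLib
import Literature.MathematicalPhysics.QuantumLattice.GaugeGroups
import Summits.Ventures.LatticeQCDFlow.Exactness.CompactHaar
import Summits.Ventures.LatticeQCDFlow.Exactness.HaarSteinSpecialUnitary
import Summits.Ventures.LatticeQCDFlow.Exactness.SubgroupHeatBath
import Summits.Ventures.LatticeQCDFlow.Exactness.CabibboMarinari

/-!
# The Cabibbo–Marinari hit of the SU(N) heat bath is an exact kernel for the one-link Wilson law

HONEST FRAMING: exact (Metropolis-corrected) sampling algorithms for lattice gauge theory;
figures of merit are autocorrelation/cost numbers at stated couplings and volumes; no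
continuum-physics claim.

Venture `LatticeQCDFlow` (cell pub-lqcd), topic `Exactness`, FANOUT row 9 (eng-latcore; the
engine's `updates.sweep(f, β, 'hb')` for `SU(N ≥ 3)`: `csrc/latcore_template.c`, one heat-bath hit
per SU(2) subgroup `(i, j)` of each link).  NEW WORK of the cell, assembling
`SubgroupHeatBath.lean` (the abstract kernel and its reversibility), `CabibboMarinari.lean` (the
block embedding `blockEmbSU e : SU(2) →* SU(n)` and the quaternionic projection) and
`CompactHaar.lean` / `GaugeGroups.lean` (Haar probability on `SU(2)`, `SU(n)`: finite, left-, right-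
and inversion-invariant, Borel); nothing is cited as a fact.

## Content (`e : n ≃ Fin 2 ⊕ m` a subgroup frame, `c = β/N`, `R` the staple sum of the link)

* `linkWeight c R g = e^{c Re tr (g R)}` as an `ℝ≥0∞` density on `SU(n)`; measurable, bounded
  above and below by `e^{±|c| Σ‖R i j‖}` (`linkWeight_le`, `le_linkWeight`), never `∞`.
* `cmHit e c R` — the engine's subgroup hit: `g ↦ φ(A) · g`, `A ∈ SU(2)` drawn with density
  `∝ linkWeight (φ(A) g)` against Haar of SU(2) (`subgroupHaarHeatBath` with `φ = blockEmbSU e`).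
* **`cmHit_isReversible`** — the hit is reversible for `linkWeight c R · Haar_SU(n)`, the one-link
  Wilson law (rest of the lattice frozen, `FibreLift.lean` / `SchwingerDysonLattice.lean`);
  `isMarkovKernel_cmHit` (the normaliser is in `(0, ∞)`), **`cmHit_invariant`**.
* `linkWeight_blockEmb` — along the subgroup the weight is `e^{(c/2) Re tr (A · quatDouble (gR)₁₁)}`
  times a factor free of `A` (`cabibboMarinari_weight`): the law the hit samples `A` from is the
  `N = 2` link law with quaternionic staple `k ŝ` — which is what the engine's SU(2) kernel
  (Kennedy–Pendleton / Creutz) is handed.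

Not here: the sweep over subgroups and links (compositions of invariant kernels,
`InvariantComposition.lean`), over-relaxation hits (same embedding, `WilsonOverrelaxation.lean`),
how the `N = 2` law is sampled (`RejectionSampling.lean`; the a₀ marginal is untyped), ergodicity.
-/

namespace Summit.Ventures.LatticeQCDFlow.Exactness

open Matrix MeasureTheory ProbabilityTheory
open scoped ENNReal

variable {n m : Type*} [Fintype n] [DecidableEq n] [Fintype m] [DecidableEq m]
  (e : n ≃ Fin 2 ⊕ m)

/-! ## §1 The one-link Wilson weight on `SU(n)` -/

/-- The one-link Wilson weight `g ↦ e^{c Re tr (g R)}` as an `ℝ≥0∞`-valued density on `SU(n)`. -/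
noncomputable def linkWeight (c : ℝ) (R : Matrix n n ℂ) (g : Matrix.specialUnitaryGroup n ℂ) : ℝ≥0∞ :=
  ENNReal.ofReal (Real.exp (c * (((g : Matrix n n ℂ) * R).trace).re))

/-- The weight is continuous … -/
theorem continuous_linkWeight (c : ℝ) (R : Matrix n n ℂ) : Continuous (linkWeight c R) := by
  unfold linkWeight
  exact ENNReal.continuous_ofReal.comp (Real.continuous_exp.comp (continuous_const.mul
    (Complex.continuous_re.comp ((continuous_subtype_val.matrix_mul continuous_const).matrix_trace))))

/-- … hence measurable. -/
theorem measurable_linkWeight (c : ℝ) (R : Matrix n n ℂ) : Measurable (linkWeight c R) :=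
  (continuous_linkWeight c R).measurable

omit [DecidableEq n] in
/-- The exponent is bounded on `SU(n)`: `|c Re tr (g R)| ≤ |c| Σ ‖R i j‖`. -/
theorem abs_exponent_le [DecidableEq n] (c : ℝ) (R : Matrix n n ℂ) (g : Matrix.specialUnitaryGroup n ℂ) :
    |c * (((g : Matrix n n ℂ) * R).trace).re| ≤ |c| * ∑ i, ∑ j, ‖R i j‖ := by
  rw [abs_mul]
  exact mul_le_mul_of_nonneg_left
    (abs_re_trace_mul_le_of_mem_unitaryGroup (Matrix.specialUnitaryGroup_le_unitaryGroup g.2) R)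
    (abs_nonneg c)

/-- Upper bound: `linkWeight c R g ≤ e^{|c| Σ‖R‖}`. -/
theorem linkWeight_le (c : ℝ) (R : Matrix n n ℂ) (g : Matrix.specialUnitaryGroup n ℂ) :
    linkWeight c R g ≤ ENNReal.ofReal (Real.exp (|c| * ∑ i, ∑ j, ‖R i j‖)) := by
  unfold linkWeight
  exact ENNReal.ofReal_le_ofReal (Real.exp_le_exp.mpr
    ((le_abs_self _).trans (abs_exponent_le c R g)))

/-- Lower bound: `e^{−|c| Σ‖R‖} ≤ linkWeight c R g`. -/
theorem le_linkWeight (c : ℝ) (R : Matrix n n ℂ) (g : Matrix.specialUnitaryGroup n ℂ) :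
    ENNReal.ofReal (Real.exp (-(|c| * ∑ i, ∑ j, ‖R i j‖))) ≤ linkWeight c R g := by
  unfold linkWeight
  exact ENNReal.ofReal_le_ofReal (Real.exp_le_exp.mpr
    ((neg_le_neg (abs_exponent_le c R g)).trans (neg_abs_le _)))

/-- The weight is finite. -/
theorem linkWeight_ne_top (c : ℝ) (R : Matrix n n ℂ) (g : Matrix.specialUnitaryGroup n ℂ) :
    linkWeight c R g ≠ ∞ := ENNReal.ofReal_ne_top

/-! ## §2 The Cabibbo–Marinari hit as a kernel on `SU(n)` -/

omit [DecidableEq n] in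
/-- `Matrix n n ℂ = n → n → ℂ` is second countable (the type synonym hides the `Pi` instance). -/
instance secondCountableTopology_matrix : SecondCountableTopology (Matrix n n ℂ) :=
  inferInstanceAs (SecondCountableTopology (n → n → ℂ))

/-- … hence so is `SU(n)`, so that its Borel structure has measurable multiplication `MeasurableMul₂`
(needed to form the kernel). -/
instance secondCountableTopology_specialUnitaryGroup :
    SecondCountableTopology (Matrix.specialUnitaryGroup n ℂ) :=
  Topology.IsEmbedding.subtypeVal.secondCountableTopology


/-- **The engine's SU(2)-subgroup heat-bath hit** in the frame `e`: `g ↦ φ(A) · g` with `A ∈ SU(2)`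
drawn with density `∝ e^{c Re tr (φ(A) g R)}` against the Haar probability of `SU(2)`. -/
noncomputable def cmHit (c : ℝ) (R : Matrix n n ℂ) :
    Kernel (Matrix.specialUnitaryGroup n ℂ) (Matrix.specialUnitaryGroup n ℂ) :=
  subgroupHaarHeatBath
    (Literature.MathematicalPhysics.QuantumFieldTheory.haarProbability
      (Matrix.specialUnitaryGroup (Fin 2) ℂ))
    (blockEmbSU e) (measurable_blockEmbSU e) (linkWeight c R)

/-- The normaliser of the hit is positive … -/
theorem cmHit_norm_ne_zero (c : ℝ) (R : Matrix n n ℂ) (g : Matrix.specialUnitaryGroup n ℂ) :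
    subgroupNorm (Literature.MathematicalPhysics.QuantumFieldTheory.haarProbability
      (Matrix.specialUnitaryGroup (Fin 2) ℂ)) (blockEmbSU e) (linkWeight c R) g ≠ 0 := by
  unfold subgroupNorm
  refine ne_of_gt (lt_of_lt_of_le ?_ (lintegral_mono fun A => le_linkWeight c R _))
  rw [lintegral_const, measure_univ, mul_one]
  exact ENNReal.ofReal_pos.mpr (Real.exp_pos _)

/-- … and finite. -/
theorem cmHit_norm_ne_top (c : ℝ) (R : Matrix n n ℂ) (g : Matrix.specialUnitaryGroup n ℂ) :
    subgroupNorm (Literature.MathematicalPhysics.QuantumFieldTheory.haarProbability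
      (Matrix.specialUnitaryGroup (Fin 2) ℂ)) (blockEmbSU e) (linkWeight c R) g ≠ ∞ := by
  unfold subgroupNorm
  refine ne_of_lt (lt_of_le_of_lt (lintegral_mono fun A => linkWeight_le c R _) ?_)
  rw [lintegral_const, measure_univ, mul_one]
  exact ENNReal.ofReal_lt_top

/-- The hit is a Markov kernel. -/
instance isMarkovKernel_cmHit (c : ℝ) (R : Matrix n n ℂ) : IsMarkovKernel (cmHit e c R) :=
  isMarkovKernel_subgroupHaarHeatBath _ _ _ (measurable_linkWeight c R)
    (cmHit_norm_ne_zero e c R) (cmHit_norm_ne_top e c R)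

/-- **The Cabibbo–Marinari hit is exact**: reversible with respect to the one-link Wilson law
`e^{c Re tr (g R)} · Haar_SU(n)(dg)`, for every frame `e`, every real `c` and every staple sum `R`. -/
theorem cmHit_isReversible (c : ℝ) (R : Matrix n n ℂ) :
    Kernel.IsReversible (cmHit e c R)
      ((Literature.MathematicalPhysics.QuantumFieldTheory.haarProbability
        (Matrix.specialUnitaryGroup n ℂ)).withDensity (linkWeight c R)) :=
  subgroupHaarHeatBath_isReversible _ _ _ _ (measurable_linkWeight c R)

/-- … hence the one-link Wilson law is invariant under the hit. -/
theorem cmHit_invariant (c : ℝ) (R : Matrix n n ℂ) :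
    Kernel.Invariant (cmHit e c R)
      ((Literature.MathematicalPhysics.QuantumFieldTheory.haarProbability
        (Matrix.specialUnitaryGroup n ℂ)).withDensity (linkWeight c R)) :=
  (cmHit_isReversible e c R).invariant

/-! ## §3 What the SU(2) kernel is handed -/

/-- **Along the subgroup the weight is the `N = 2` link law with quaternionic staple**:
`linkWeight c R (φ(A) g) = e^{(c/2) Re tr (A · quatDouble (gR)₁₁)} · e^{c Re tr (gR)₂₂}`, the second
factor free of `A`. -/
theorem linkWeight_blockEmb (c : ℝ) (R : Matrix n n ℂ) (A : Matrix.specialUnitaryGroup (Fin 2) ℂ)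
    (g : Matrix.specialUnitaryGroup n ℂ) :
    linkWeight c R (blockEmbSU e A * g)
      = ENNReal.ofReal (Real.exp (c / 2 * (((A : Matrix (Fin 2) (Fin 2) ℂ)
            * quatDouble (((g : Matrix n n ℂ) * R).submatrix e.symm e.symm).toBlocks₁₁).trace).re))
        * ENNReal.ofReal (Real.exp (c * (((((g : Matrix n n ℂ) * R).submatrix e.symm e.symm).toBlocks₂₂).trace).re)) := by
  rw [linkWeight, ← ENNReal.ofReal_mul (Real.exp_nonneg _), Submonoid.coe_mul, coe_blockEmbSU,
    cabibboMarinari_weight e (IsQuat.of_mem_specialUnitaryGroup A.2) c (g : Matrix n n ℂ) R]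

end Summit.Ventures.LatticeQCDFlow.Exactness
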